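import Summits.SmoothPoincare4.SmoothPoincare4.Theorems.CongruenceShadowsShadowApproximationStubFramingZeroAbelian

/-!
# Stub `stub_framingZero` of line `epi-class-livingston` for crux `CongruenceShadows.ShadowApproximation`
(item stmt-SmoothPoincare4-14595, route route-SmoothPoincare4-CongruenceShadows) — part B:
integer lattice triples that are standard modulo every prime are standard

Second support file of `stub_framingZero` (imports part A, `…StubFramingZeroAbelian`).  Pure
linear algebra over `ℤ` and the prime fields, fully proved; the registered statement is
**`exists_adapted_equiv`**: let `Λ₀, Λ₁, Λ₂ ≤ ℤ⁶` (`ℤ⁶ = V3 = surfaceGen 3 → ℤ`) be integer lattices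
such that

* (u) each `Λᵢ ∩ Λⱼ`, `i < j`, contains a vector nonzero modulo every prime;
* (w) each `Λᵢ` contains a vector `wᵢ` with `χ wᵢ = 1` for some integer functional `χ` killing the
  two other lattices;
* (p) for every prime `p` some linear automorphism of `(ZMod p)⁶` carries the coordinate triple
  `(C₀, C₁, C₂)`, `Cᵢ = coord _ (s4Gens i) = ⟨e_x : x ∈ s4Gens i⟩` (the abelianised standard
  kernels of the genus-3 trisection of `S⁴`), onto the reduced triple `(Λ̄₀, Λ̄₁, Λ̄₂)`.

Then `(Λ₀, Λ₁, Λ₂) = g(C₀, C₁, C₂)` for some `g ∈ GL₆(ℤ)`.  Proof (no ranks, no Smith normal form):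
the integer matrix `G` whose column at a shared generator `a_k ∈ s4Gens i ∩ s4Gens j` is the
vector of (u) and whose column at the private generator `b ∈ s4Gens i` is `wᵢ` maps `Cᵢ` into
`Λᵢ`; modulo `p`, pulling its columns back along the automorphism of (p) yields six vectors with
the sparse pattern of `linearIndependent_of_admissible` (row `b₂, b₁, b₀` then `a₀, a₁, a₂` each
with a single live entry), so `p ∤ det G` for every prime, i.e. `det G = ±1`
(`isUnit_of_forall_prime_not_dvd`); finally `g Cᵢ ≤ Λᵢ` have the same reduction modulo every
prime (a dimension count in `(ZMod p)⁶`), which forces equality because an integer vector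
divisible by every prime vanishes (`eq_zero_of_forall_prime_dvd`). [folklore]
-/

-- the prescribed namespace `Summit.<P>.<Sub>.…` duplicates `SmoothPoincare4` (P = Sub)
set_option linter.dupNamespace false
noncomputable section
open Literature.Topology.FourManifolds

namespace Summit.SmoothPoincare4.SmoothPoincare4.Theorems.ShadowApproximation.EpiClassLivingston

/-! ## A sparse pattern of six vectors is linearly independent -/

/-- `x` is an admissible coordinate for the vector attached to `y`: `x` lies in every standard
generator set `s4Gens i` that contains `y`. -/
def admissible (y x : surfaceGen 3) : Bool := decide (∀ i : Fin 3, y ∈ s4Gens i → x ∈ s4Gens i)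

/-- **Pattern lemma.** Six vectors `w_y ∈ F⁶` (`y ∈ surfaceGen 3`) with `w_y(y) ≠ 0` and
`w_y(x) = 0` unless `x` is admissible for `y` are linearly independent: the rows `b₂, b₁, b₀` of
the matrix `(w_y(x))` have a single nonzero entry (the diagonal one), and then so do the rows
`a₀, a₁, a₂`. [folklore] -/
theorem linearIndependent_of_admissible {F : Type*} [Field F] (w : surfaceGen 3 → surfaceGen 3 → F)
    (hdiag : ∀ y, w y y ≠ 0) (hoff : ∀ y x, admissible y x = false → w y x = 0) :
    LinearIndependent F w := by
  rw [Fintype.linearIndependent_iff]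
  intro c hc
  have row : ∀ x, c ((0 : Fin 3), false) * w ((0 : Fin 3), false) x +
      c ((0 : Fin 3), true) * w ((0 : Fin 3), true) x +
      (c ((1 : Fin 3), false) * w ((1 : Fin 3), false) x + c ((1 : Fin 3), true) * w ((1 : Fin 3), true) x) +
      (c ((2 : Fin 3), false) * w ((2 : Fin 3), false) x + c ((2 : Fin 3), true) * w ((2 : Fin 3), true) x) = 0 := by
    intro x
    have := congr_fun hc x
    simp only [Finset.sum_apply, Pi.smul_apply, smul_eq_mul, Pi.zero_apply] at this
    rw [Fintype.sum_prod_type, Fin.sum_univ_three] at this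
    simpa only [Fintype.sum_bool, add_comm (c (_, true) * _)] using this
  have hb2 : c ((2 : Fin 3), true) = 0 := by
    have h := row ((2 : Fin 3), true)
    simp (disch := decide) only [hoff, mul_zero, add_zero, zero_add] at h
    exact (mul_eq_zero.1 h).resolve_right (hdiag _)
  have hb1 : c ((1 : Fin 3), true) = 0 := by
    have h := row ((1 : Fin 3), true)
    simp (disch := decide) only [hoff, mul_zero, add_zero, zero_add] at h
    exact (mul_eq_zero.1 h).resolve_right (hdiag _)
  have hb0 : c ((0 : Fin 3), true) = 0 := by
    have h := row ((0 : Fin 3), true)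
    simp (disch := decide) only [hoff, mul_zero, add_zero, zero_add] at h
    exact (mul_eq_zero.1 h).resolve_right (hdiag _)
  have ha0 : c ((0 : Fin 3), false) = 0 := by
    have h := row ((0 : Fin 3), false)
    simp (disch := decide) only [hoff, hb0, hb1, hb2, mul_zero, zero_mul, add_zero] at h
    exact (mul_eq_zero.1 h).resolve_right (hdiag _)
  have ha1 : c ((1 : Fin 3), false) = 0 := by
    have h := row ((1 : Fin 3), false)
    simp (disch := decide) only [hoff, hb0, hb1, hb2, mul_zero, zero_mul, add_zero, zero_add] at h
    exact (mul_eq_zero.1 h).resolve_right (hdiag _)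
  have ha2 : c ((2 : Fin 3), false) = 0 := by
    have h := row ((2 : Fin 3), false)
    simp (disch := decide) only [hoff, hb0, hb1, hb2, mul_zero, zero_mul, add_zero, zero_add] at h
    exact (mul_eq_zero.1 h).resolve_right (hdiag _)
  rintro ⟨i, _ | _⟩ <;> fin_cases i <;> assumption

/-! ## Local-to-global for integers -/

/-- An integer divisible by no prime is a unit. [folklore] -/
theorem isUnit_of_forall_prime_not_dvd {z : ℤ} (h : ∀ p : ℕ, p.Prime → ¬ (p : ℤ) ∣ z) :
    IsUnit z := by
  rw [Int.isUnit_iff_natAbs_eq]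
  by_contra hne
  obtain ⟨p, hp, hpd⟩ := Nat.exists_prime_and_dvd hne
  exact h p hp (Int.natCast_dvd.2 hpd)

/-- An integer divisible by every prime is zero. [folklore] -/
theorem eq_zero_of_forall_prime_dvd {z : ℤ} (h : ∀ p : ℕ, p.Prime → (p : ℤ) ∣ z) : z = 0 := by
  by_contra hz
  obtain ⟨p, hle, hp⟩ := Nat.exists_infinite_primes (z.natAbs + 1)
  have := Nat.le_of_dvd (Int.natAbs_pos.2 hz) (Int.natCast_dvd.1 (h p hp))
  omega

/-! ## Lattice triples standard modulo every prime -/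

/-- The reduction mod `p` of an integer functional `χ : ℤ⁶ → ℤ`. -/
def redFun (p : ℕ) (χ : V3 →ₗ[ℤ] ℤ) : V3p p →ₗ[ZMod p] ZMod p :=
  Fintype.linearCombination (ZMod p) fun x => (χ (e3 x) : ZMod p)

/-- `redFun p χ (red v) = χ v mod p`. [folklore] -/
theorem redFun_red (p : ℕ) (χ : V3 →ₗ[ℤ] ℤ) (v : V3) : redFun p χ (red p v) = (χ v : ZMod p) := by
  let M₂ : V3 →ₗ[ℤ] ZMod p :=
    { toFun := fun v => (χ v : ZMod p)
      map_add' := fun a b => by simp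
      map_smul' := fun c a => by
        change (χ (c • a) : ZMod p) = c • (χ a : ZMod p)
        rw [map_smul, zsmul_eq_mul, zsmul_eq_mul, Int.cast_mul, Int.cast_id] }
  have key : ((redFun p χ).restrictScalars ℤ) ∘ₗ red p = M₂ := by
    refine (Pi.basisFun ℤ (surfaceGen 3)).ext fun x => ?_
    rw [Pi.basisFun_apply, LinearMap.comp_apply, LinearMap.restrictScalars_apply]
    change redFun p χ (red p (e3 x)) = (χ (e3 x) : ZMod p)
    rw [red_e3, redFun, Fintype.linearCombination_apply_single, one_smul]
  exact LinearMap.congr_fun key v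

/-- **Abelian standardness from the primes.** Let `Λ₀, Λ₁, Λ₂ ≤ ℤ⁶` be integer lattices such that
(u) each `Λᵢ ∩ Λⱼ` (`i < j`) contains a vector that is nonzero modulo every prime, (w) each `Λᵢ`
contains a vector `wᵢ` on which some integer functional killing the other two lattices takes the
value `1`, and (p) modulo every prime `p` the reduced triple `(Λ̄₀, Λ̄₁, Λ̄₂)` is the image of the
coordinate triple `(C₀, C₁, C₂)`, `Cᵢ = ⟨e_x : x ∈ s4Gens i⟩`, under a linear automorphism of
`(ZMod p)⁶`.  Then `(Λ₀, Λ₁, Λ₂) = g (C₀, C₁, C₂)` for some `g ∈ GL₆(ℤ)`.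
Proof: the matrix `G` whose column `y` is `u_{ij}` (for the shared generator `y = a_k` of
`s4Gens i ∩ s4Gens j`) resp. `wᵢ` (for the private generator `y = b` of `s4Gens i`) maps `Cᵢ` into
`Λᵢ`; modulo `p`, transporting its columns by the automorphism of (p) gives the sparse pattern of
`linearIndependent_of_admissible`, so `det G` is prime to every `p`, i.e. `G ∈ GL₆(ℤ)`; and
`g Cᵢ ≤ Λᵢ` with equal reductions modulo every prime forces `g Cᵢ = Λᵢ` (a vector of `ℤ⁶`
divisible by every prime vanishes). [folklore] -/
theorem exists_adapted_equiv :
    ∀ Λ : Fin 3 → Submodule ℤ V3,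
      (∀ i j : Fin 3, i < j → ∃ u, u ∈ Λ i ∧ u ∈ Λ j ∧ ∀ p : ℕ, p.Prime → red p u ≠ 0) →
      (∀ i : Fin 3, ∃ w ∈ Λ i, ∃ χ : V3 →ₗ[ℤ] ℤ, χ w = 1 ∧ ∀ j, j ≠ i → ∀ v ∈ Λ j, χ v = 0) →
      (∀ p : ℕ, p.Prime → ∃ ψ : V3p p ≃ₗ[ZMod p] V3p p,
        ∀ i, (coord (ZMod p) (s4Gens i)).map (ψ : V3p p →ₗ[ZMod p] V3p p) = redSub p (Λ i)) →
      ∃ g : V3 ≃ₗ[ℤ] V3, ∀ i, (coord ℤ (s4Gens i)).map (g : V3 →ₗ[ℤ] V3) = Λ i := by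
  intro Λ hu hw hψp
  classical
  obtain ⟨u01, hu01a, hu01b, hu01p⟩ := hu 0 1 (by decide)
  obtain ⟨u02, hu02a, hu02b, hu02p⟩ := hu 0 2 (by decide)
  obtain ⟨u12, hu12a, hu12b, hu12p⟩ := hu 1 2 (by decide)
  obtain ⟨w0, hw0, χ0, hχ0, hχ0'⟩ := hw 0
  obtain ⟨w1, hw1, χ1, hχ1, hχ1'⟩ := hw 1
  obtain ⟨w2, hw2, χ2, hχ2, hχ2'⟩ := hw 2
  -- the six vectors, indexed by the standard generator they stand in for
  let vec : surfaceGen 3 → V3 := fun y =>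
    if y = ((0 : Fin 3), false) then u01 else if y = ((1 : Fin 3), false) then u02
    else if y = ((2 : Fin 3), false) then u12 else if y = ((2 : Fin 3), true) then w0
    else if y = ((1 : Fin 3), true) then w1 else w2
  have v0f : vec ((0 : Fin 3), false) = u01 := by simp [vec]
  have v1f : vec ((1 : Fin 3), false) = u02 := by simp [vec]
  have v2f : vec ((2 : Fin 3), false) = u12 := by simp [vec]
  have v2t : vec ((2 : Fin 3), true) = w0 := by simp [vec]
  have v1t : vec ((1 : Fin 3), true) = w1 := by simp [vec]
  have v0t : vec ((0 : Fin 3), true) = w2 := by simp [vec]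
  have hvec : ∀ i : Fin 3, ∀ y ∈ s4Gens i, vec y ∈ Λ i := by
    intro i y hy
    fin_cases i
    · change y ∈ ({((0 : Fin 3), false), ((1 : Fin 3), false), ((2 : Fin 3), true)} : Finset _) at hy
      simp only [Finset.mem_insert, Finset.mem_singleton] at hy
      rcases hy with rfl | rfl | rfl
      · rw [v0f]; exact hu01a
      · rw [v1f]; exact hu02a
      · rw [v2t]; exact hw0
    · change y ∈ ({((0 : Fin 3), false), ((1 : Fin 3), true), ((2 : Fin 3), false)} : Finset _) at hy
      simp only [Finset.mem_insert, Finset.mem_singleton] at hy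
      rcases hy with rfl | rfl | rfl
      · rw [v0f]; exact hu01b
      · rw [v1t]; exact hw1
      · rw [v2f]; exact hu12a
    · change y ∈ ({((0 : Fin 3), true), ((1 : Fin 3), false), ((2 : Fin 3), false)} : Finset _) at hy
      simp only [Finset.mem_insert, Finset.mem_singleton] at hy
      rcases hy with rfl | rfl | rfl
      · rw [v0t]; exact hw2
      · rw [v1f]; exact hu02b
      · rw [v2f]; exact hu12b
  have hred : ∀ k : Fin 3, ∀ p : ℕ, p.Prime → red p (vec (k, false)) ≠ 0 := by
    intro k
    fin_cases k
    · rw [show ((⟨0, by omega⟩ : Fin 3), false) = ((0 : Fin 3), false) from rfl, v0f]; exact hu01p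
    · rw [show ((⟨1, by omega⟩ : Fin 3), false) = ((1 : Fin 3), false) from rfl, v1f]; exact hu02p
    · rw [show ((⟨2, by omega⟩ : Fin 3), false) = ((2 : Fin 3), false) from rfl, v2f]; exact hu12p
  have hchi : ∀ k : Fin 3, ∃ χ : V3 →ₗ[ℤ] ℤ, χ (vec (k, true)) = 1 ∧
      ∀ j, (k, true) ∉ s4Gens j → ∀ v ∈ Λ j, χ v = 0 := by
    intro k
    fin_cases k
    · refine ⟨χ2, ?_, fun j hj => hχ2' j ?_⟩
      · rw [show ((⟨0, by omega⟩ : Fin 3), true) = ((0 : Fin 3), true) from rfl, v0t]; exact hχ2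
      · rintro rfl; exact hj (by decide)
    · refine ⟨χ1, ?_, fun j hj => hχ1' j ?_⟩
      · rw [show ((⟨1, by omega⟩ : Fin 3), true) = ((1 : Fin 3), true) from rfl, v1t]; exact hχ1
      · rintro rfl; exact hj (by decide)
    · refine ⟨χ0, ?_, fun j hj => hχ0' j ?_⟩
      · rw [show ((⟨2, by omega⟩ : Fin 3), true) = ((2 : Fin 3), true) from rfl, v2t]; exact hχ0
      · rintro rfl; exact hj (by decide)
  -- the integer matrix with columns `vec y`
  let G : Matrix (surfaceGen 3) (surfaceGen 3) ℤ := Matrix.of fun x y => vec y x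
  -- admissibility bookkeeping on the finite pattern
  have hadm_a : ∀ (k : Fin 3) (x : surfaceGen 3), x ≠ (k, false) → admissible (k, false) x = false := by
    decide
  have hadm_b : ∀ (k : Fin 3) (x : surfaceGen 3), x ≠ (k, true) →
      ∃ j, x ∈ s4Gens j ∧ (k, true) ∉ s4Gens j := by
    decide
  -- `det G` is prime to every prime
  have hdetp : ∀ p : ℕ, p.Prime → ¬ (p : ℤ) ∣ G.det := by
    intro p hp
    haveI : Fact p.Prime := ⟨hp⟩
    obtain ⟨ψ, hψ⟩ := hψp p hp
    let wv : surfaceGen 3 → V3p p := fun y => ψ.symm (red p (vec y))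
    have hwv_mem : ∀ i y, y ∈ s4Gens i → wv y ∈ coord (ZMod p) (s4Gens i) := by
      intro i y hy
      have h1 : red p (vec y) ∈ redSub p (Λ i) := red_mem_redSub p (hvec i y hy)
      rw [← hψ i, Submodule.mem_map] at h1
      obtain ⟨c, hc, hcy⟩ := h1
      have : wv y = c := by
        show ψ.symm (red p (vec y)) = c
        rw [← hcy]
        exact ψ.symm_apply_apply c
      rw [this]
      exact hc
    have hoff : ∀ y x, admissible y x = false → wv y x = 0 := by
      intro y x h
      have h' : ¬ ∀ i : Fin 3, y ∈ s4Gens i → x ∈ s4Gens i := by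
        simpa [admissible] using h
      push Not at h'
      obtain ⟨i, hy, hx⟩ := h'
      exact (mem_coord.1 (hwv_mem i y hy)) x hx
    have hdiag : ∀ y, wv y y ≠ 0 := by
      rintro ⟨k, _ | _⟩
      · -- shared generator: `wv` is supported at `y` and nonzero
        intro h0
        apply hred k p hp
        have hzero : wv (k, false) = 0 := by
          funext x
          by_cases hx : x = (k, false)
          · rw [hx]; exact h0
          · exact hoff _ _ (hadm_a k x hx)
        have : red p (vec (k, false)) = ψ (wv (k, false)) := (ψ.apply_symm_apply _).symm
        rw [this, hzero, map_zero]
      · -- private generator: use the functional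
        obtain ⟨χ, hχ1, hχ0⟩ := hchi k
        have hkill : ∀ x, x ≠ (k, true) → redFun p χ (ψ (Pi.single x 1)) = 0 := by
          intro x hx
          obtain ⟨j, hxj, hyj⟩ := hadm_b k x hx
          have hmem : ψ (Pi.single x 1) ∈ redSub p (Λ j) := by
            rw [← hψ j]
            refine Submodule.mem_map_of_mem (mem_coord.2 fun z hz => ?_)
            exact Pi.single_eq_of_ne (fun h => hz (by rw [h]; exact hxj)) _
          obtain ⟨v, hv, hvx⟩ := (mem_redSub p).1 hmem
          rw [← hvx, redFun_red, hχ0 j hyj v hv, Int.cast_zero]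
        have hexp : ∀ w : V3p p,
            redFun p χ (ψ w) = w (k, true) * redFun p χ (ψ (Pi.single (k, true) 1)) := by
          intro w
          conv_lhs => rw [← Finset.univ_sum_single w]
          rw [map_sum, map_sum, Finset.sum_eq_single (k, true)]
          · rw [show (Pi.single (k, true) (w (k, true)) : V3p p) =
                w (k, true) • Pi.single (k, true) (1 : ZMod p) by
                  rw [← Pi.single_smul, smul_eq_mul, mul_one],
              map_smul, map_smul, smul_eq_mul]
          · intro x _ hx
            rw [show (Pi.single x (w x) : V3p p) = w x • Pi.single x (1 : ZMod p) by
                  rw [← Pi.single_smul, smul_eq_mul, mul_one],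
              map_smul, map_smul, hkill x hx, smul_zero]
          · intro h; exact absurd (Finset.mem_univ _) h
        intro h0
        have h1 : redFun p χ (ψ (wv (k, true))) = 1 := by
          show redFun p χ (ψ (ψ.symm (red p (vec (k, true))))) = 1
          rw [LinearEquiv.apply_symm_apply, redFun_red, hχ1, Int.cast_one]
        rw [hexp, h0, zero_mul] at h1
        exact zero_ne_one h1
    have hli : LinearIndependent (ZMod p) wv := linearIndependent_of_admissible wv hdiag hoff
    have hli' : LinearIndependent (ZMod p) (fun y => red p (vec y)) := by
      have hfun : (fun y => red p (vec y)) = (ψ : V3p p →ₗ[ZMod p] V3p p) ∘ wv := by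
        funext y
        simp [wv]
      rw [hfun]
      exact hli.map' (ψ : V3p p →ₗ[ZMod p] V3p p) ψ.ker
    have hcols : (G.map (Int.castRingHom (ZMod p))).col = fun y => red p (vec y) := by
      funext y x
      rfl
    have hunit : IsUnit (G.map (Int.castRingHom (ZMod p))) :=
      Matrix.linearIndependent_cols_iff_isUnit.1 (hcols ▸ hli')
    rw [Matrix.isUnit_iff_isUnit_det, ← RingHom.mapMatrix_apply, ← RingHom.map_det] at hunit
    intro hdvd
    exact hunit.ne_zero ((ZMod.intCast_zmod_eq_zero_iff_dvd _ _).2 hdvd)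
  have hdet : IsUnit G.det := isUnit_of_forall_prime_not_dvd hdetp
  let g : V3 ≃ₗ[ℤ] V3 := Matrix.toLinearEquiv' G (Matrix.invertibleOfIsUnitDet G hdet)
  have hg : ∀ v, g v = G.mulVec v := fun v => rfl
  have hge : ∀ y, g (e3 y) = vec y := by
    intro y
    rw [hg]
    change G.mulVec (Pi.single y 1) = vec y
    rw [Matrix.mulVec_single_one]
    rfl
  have hle : ∀ i, (coord ℤ (s4Gens i)).map (g : V3 →ₗ[ℤ] V3) ≤ Λ i := by
    rintro i _ ⟨c, hc, rfl⟩
    rw [LinearEquiv.coe_coe, ← Finset.univ_sum_single c, map_sum]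
    refine Submodule.sum_mem _ fun y _ => ?_
    by_cases hy : y ∈ s4Gens i
    · rw [single_eq_smul_e3, map_smul, hge]
      exact Submodule.smul_mem _ _ (hvec i y hy)
    · rw [(mem_coord.1 hc) y hy, Pi.single_zero, map_zero]
      exact zero_mem _
  refine ⟨g, fun i => le_antisymm (hle i) fun b hb => ?_⟩
  -- sandwich modulo every prime
  refine ⟨g.symm b, mem_coord.2 fun x hx => ?_, g.apply_symm_apply b⟩
  apply eq_zero_of_forall_prime_dvd
  intro p hp
  haveI : Fact p.Prime := ⟨hp⟩
  obtain ⟨ψ, hψ⟩ := hψp p hp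
  have hunitp : IsUnit (G.map (Int.castRingHom (ZMod p))).det := by
    rw [← RingHom.mapMatrix_apply, ← RingHom.map_det]
    exact hdet.map _
  let gp : V3p p ≃ₗ[ZMod p] V3p p :=
    Matrix.toLinearEquiv' _ (Matrix.invertibleOfIsUnitDet _ hunitp)
  have hgp : ∀ v : V3, gp (red p v) = red p (g v) := by
    intro v
    funext z
    change ((G.map (Int.castRingHom (ZMod p))).mulVec (red p v)) z =
      (Int.castRingHom (ZMod p)) ((G.mulVec v) z)
    rw [RingHom.map_mulVec]
    rfl
  have hle' : (coord (ZMod p) (s4Gens i)).map (gp : V3p p →ₗ[ZMod p] V3p p) ≤ redSub p (Λ i) := by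
    rintro _ ⟨cb, hcb, rfl⟩
    rw [← redSub_coord p (s4Gens i)] at hcb
    obtain ⟨cz, hcz, rfl⟩ := (mem_redSub p).1 hcb
    rw [LinearEquiv.coe_coe, hgp]
    exact red_mem_redSub p (hle i ⟨cz, hcz, rfl⟩)
  have heq : (coord (ZMod p) (s4Gens i)).map (gp : V3p p →ₗ[ZMod p] V3p p) = redSub p (Λ i) := by
    apply Submodule.eq_of_le_of_finrank_eq hle'
    rw [LinearEquiv.finrank_map_eq, ← hψ i, LinearEquiv.finrank_map_eq]
  have hb' : red p b ∈ (coord (ZMod p) (s4Gens i)).map (gp : V3p p →ₗ[ZMod p] V3p p) := by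
    rw [heq]
    exact red_mem_redSub p hb
  obtain ⟨cb, hcb, hcbb⟩ := hb'
  have hc : red p (g.symm b) = cb := by
    apply gp.injective
    rw [hgp, LinearEquiv.apply_symm_apply, ← hcbb, LinearEquiv.coe_coe]
  have hcx : red p (g.symm b) x = 0 := by
    rw [hc]
    exact (mem_coord.1 hcb) x hx
  exact (ZMod.intCast_zmod_eq_zero_iff_dvd _ _).1 hcx

end Summit.SmoothPoincare4.SmoothPoincare4.Theorems.ShadowApproximation.EpiClassLivingston
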